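import Summits.Ventures.YMGap.FlowData.RectTubePlaquetteGlueballWindow
import Summits.Ventures.YMGap.FlowData.RectTubeStrongCouplingWindow
import HarnessLib

/-!
# Venture YMGap, track Y3 FLOW-DATA — the GLUEBALL CEILING in terms of the TORELON: on every rectangular SU(2) tube
# with two sides `≥ 2`, `m′ ≤ (4/Ls μ)·E_μ + (8/Ls μ + 2)·β·#P + ln 2` at EVERY Wilson coupling `β > 0` (theorems only)

HONEST FRAMING: venture file of the cell `pub-ymgap` (QuantumFields programme), track Y3; a corollary joining two tree
windows for the typed rectangular-tube objects — the one-plaquette GLUEBALL CEILING of `RectTubePlaquetteGlueballWindow`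
(`m′(β) ≤ 4·(−ln u(β)) + 2β·#P + ln 2`, FLOW-PLAN O5) and the STRONG-COUPLING WINDOW of `RectTubeStrongCouplingWindow`
(`|E_μ − (Ls μ)·(−ln u(β))| ≤ 2β·#P`, FLOW-PLAN O1).  Eliminating the one-plaquette ratio `−ln u(β)` between them bounds the
trivial-flux gap `m′ = su2RectMassGapPrime β Ls` by the torelon energy `E_μ = su2RectTorelonEnergy β Ls μ` of ANY axis `μ`
DIRECTLY, with no Bessel function left in the statement:

* ★ `su2RectMassGapPrime_le_torelon` — `m′ ≤ (4/Ls μ)·E_μ + (8/Ls μ + 2)·β·#P + ln 2`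
  (`#P = #sites · k(k−1)/2` spatial plaquettes per slice; needs two sides `Ls μ', Ls ν ≥ 2`, `μ' ≠ ν`, for the plaquette
  witness — the axis `μ` of the torelon is arbitrary);
* `su2RectMassGapPrime_le_torelon_dim3` — the `k = 2` reading `m′ ≤ (4/L₁)·E₁ + (8/L₁ + 2)·β·L₁L₂ + ln 2` (and the
  `μ = 1` twin), the form flow-theory reads against the O5/O1 columns of the `2×3`, `2×4`, `L×L` cells;
* `su2RectMassGapPrime_sub_torelon_le` — the small-β reading `m′ − (4/Ls μ)·E_μ ≤ ln 2 + (8/Ls μ + 2)·β·#P`: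
  to leading order at strong coupling the glueball proxy is at most four torelon energies PER UNIT LENGTH plus `ln 2`.

Finite tubes only; both inputs are hypothesis-free tree theorems; no number of the FLOW-TABLE, nothing about `L → ∞`,
the continuum or a mass gap in the thermodynamic sense.

References: I. Montvay, G. Münster (1994) §3.2.6 [cite: MontvayMunster1994, §3.2.6]; G. Münster, Nucl. Phys. B 190
(1981) §2 [cite: Munster1981, §2]; M. Reed, B. Simon IV (1978) XIII.12 [cite: ReedSimonIV1978, Thm XIII.44].
-/

noncomputable section

open Literature.MathematicalPhysics.QuantumLattice (RectTorusSite)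
open Summit.Ventures.YMGap.Conjectures (su2CharacterRatio)

namespace Summit.Ventures.YMGap.FlowData

section GlueballTorelon

variable {k : ℕ} {β : ℝ}

/-- ★ **THE GLUEBALL CEILING IN TERMS OF THE TORELON.**  On the rectangular SU(2) tube `×_i ℤ/(Ls i)` with two sides
`Ls μ' , Ls ν ≥ 2` (`μ' ≠ ν`), at every Wilson coupling `β > 0` and for EVERY axis `μ`:
`m′ ≤ (4/Ls μ)·E_μ + (8/Ls μ + 2)·β·#P + ln 2`, `#P = #sites · #{unordered axis pairs}`.
Proof: `m′ ≤ 4(−ln u) + 2β#P + ln 2` (plaquette glueball window) and `(Ls μ)(−ln u) ≤ E_μ + 2β#P` (strong-coupling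
window, lower half). [cite: MontvayMunster1994, §3.2.6] -/
theorem su2RectMassGapPrime_le_torelon (hβ : 0 < β) (Ls : Fin k → ℕ) [∀ i, NeZero (Ls i)] {μ' ν : Fin k}
    (hμν : μ' ≠ ν) (hμ' : 2 ≤ Ls μ') (hν : 2 ≤ Ls ν) (μ : Fin k) :
    su2RectMassGapPrime β Ls ≤
      4 / (Ls μ : ℝ) * su2RectTorelonEnergy β Ls μ +
        (8 / (Ls μ : ℝ) + 2) * β * (Fintype.card (RectTorusSite Ls) * Fintype.card {p : Fin k × Fin k // p.1 < p.2}) +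
        Real.log 2 := by
  have hPG := su2RectMassGapPrime_le_plaquette' hβ Ls hμν hμ' hν
  have hW := (abs_sub_le_iff.1 (abs_su2RectTorelonEnergy_sub_le hβ Ls μ)).2
  have hL : (0 : ℝ) < (Ls μ : ℝ) := Nat.cast_pos.2 (Nat.pos_of_ne_zero (NeZero.ne (Ls μ)))
  set P : ℝ := (Fintype.card (RectTorusSite Ls) : ℝ) * (Fintype.card {p : Fin k × Fin k // p.1 < p.2} : ℝ) with hP
  set v : ℝ := -Real.log (su2CharacterRatio β) with hv
  -- `(Ls μ)·v ≤ E_μ + 2β#P`, divide by `Ls μ`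
  have hv_le : v ≤ (su2RectTorelonEnergy β Ls μ + 2 * β * P) / (Ls μ : ℝ) := by
    rw [le_div_iff₀ hL]
    linarith
  have h4 : 4 * v ≤ 4 / (Ls μ : ℝ) * su2RectTorelonEnergy β Ls μ + 8 / (Ls μ : ℝ) * β * P := by
    have := mul_le_mul_of_nonneg_left hv_le (by norm_num : (0 : ℝ) ≤ 4)
    calc 4 * v ≤ 4 * ((su2RectTorelonEnergy β Ls μ + 2 * β * P) / (Ls μ : ℝ)) := this
      _ = 4 / (Ls μ : ℝ) * su2RectTorelonEnergy β Ls μ + 8 / (Ls μ : ℝ) * β * P := by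
        field_simp
        ring
  calc su2RectMassGapPrime β Ls ≤ 4 * v + 2 * β * P + Real.log 2 := hPG
    _ ≤ 4 / (Ls μ : ℝ) * su2RectTorelonEnergy β Ls μ + 8 / (Ls μ : ℝ) * β * P + 2 * β * P + Real.log 2 := by
        linarith
    _ = 4 / (Ls μ : ℝ) * su2RectTorelonEnergy β Ls μ + (8 / (Ls μ : ℝ) + 2) * β * P + Real.log 2 := by ring

/-- The small-β reading: `m′ − (4/Ls μ)·E_μ ≤ ln 2 + (8/Ls μ + 2)·β·#P` — at strong coupling the trivial-flux gap is
at most four torelon energies per unit length plus `ln 2`, up to `O(β·#P)`. [cite: MontvayMunster1994, §3.2.6] -/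
theorem su2RectMassGapPrime_sub_torelon_le (hβ : 0 < β) (Ls : Fin k → ℕ) [∀ i, NeZero (Ls i)] {μ' ν : Fin k}
    (hμν : μ' ≠ ν) (hμ' : 2 ≤ Ls μ') (hν : 2 ≤ Ls ν) (μ : Fin k) :
    su2RectMassGapPrime β Ls - 4 / (Ls μ : ℝ) * su2RectTorelonEnergy β Ls μ ≤
      Real.log 2 +
        (8 / (Ls μ : ℝ) + 2) * β * (Fintype.card (RectTorusSite Ls) * Fintype.card {p : Fin k × Fin k // p.1 < p.2}) := by
  linarith [su2RectMassGapPrime_le_torelon hβ Ls hμν hμ' hν μ]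

/-- **`k = 2` reading (d = 3 tubes `L₀ × L₁`, both sides `≥ 2`)**, axis `0`:
`m′ ≤ (4/L₀)·E₀ + (8/L₀ + 2)·β·L₀L₁ + ln 2`. [cite: MontvayMunster1994, §3.2.6] -/
theorem su2RectMassGapPrime_le_torelon_dim3 (hβ : 0 < β) (Ls : Fin 2 → ℕ) [∀ i, NeZero (Ls i)]
    (h0 : 2 ≤ Ls 0) (h1 : 2 ≤ Ls 1) (μ : Fin 2) :
    su2RectMassGapPrime β Ls ≤
      4 / (Ls μ : ℝ) * su2RectTorelonEnergy β Ls μ + (8 / (Ls μ : ℝ) + 2) * β * ((Ls 0 : ℝ) * (Ls 1 : ℝ)) +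
        Real.log 2 := by
  have h := su2RectMassGapPrime_le_torelon hβ Ls (μ' := 0) (ν := 1) (by decide) h0 h1 μ
  have hp : Fintype.card {p : Fin 2 × Fin 2 // p.1 < p.2} = 1 := by decide
  rw [card_rectTorusSite_two, hp] at h
  push_cast at h
  simpa only [mul_one] using h

end GlueballTorelon

end Summit.Ventures.YMGap.FlowData
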